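import Mathlib.CategoryTheory.Subobject.Basic
import Literature.AnabelianGeometry.SemiGraphs.GraphOfAnabelioids

/-!
# Galois-countable semi-graphs of anabelioids ([IUTchI] Remark 2.5.3 (i) (T2); [SemiAnbd] p. 23)

(File `GaloisCountableGraphs.lean`; the sibling `GaloisCountable.lean` holds (T1) for tempered groups.)

Mochizuki, *Inter-universal Teichmüller theory I*, Remark 2.5.3 (i), kurims manuscript p. 52
[cite: Mochizuki2012, IUTchI Rem. 2.5.3(i)(T2) p.52] — an erratum/complement to [SemiAnbd]
("certain minor oversights … certain pathologies occur in the theory of tempered fundamental groups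
if one does not impose suitable countability hypotheses"):

* (T2) "a semi-graph of anabelioids `𝒢` is *Galois-countable* if it is countable, and, moreover,
  admits a countable collection of finite étale coverings `{𝒢_i → 𝒢}_{i ∈ I}` such that for any finite
  étale covering `ℋ → 𝒢`, there exists an `i ∈ I` such that the base-changed covering
  `ℋ ×_𝒢 𝒢_i → 𝒢_i` splits over the constituent anabelioid associated to each component of [the
  underlying semi-graph of] `𝒢_i`."

Also here (moved up from the finite-étale-coverings file so that §3 can import it cheaply): the
connected components `π₀Obj X` of an object of a connected anabelioid ([SemiAnbd] p. 23) and the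
relation "`X` splits over `P`".

Rendering.  Finite étale coverings `𝒢_i → 𝒢`, `ℋ → 𝒢` are objects `A_i`, `B` of `B(𝒢)` ([SemiAnbd]
Def. 2.2 (i)); the components of `𝒢_i` over a vertex `v` (resp. edge `e`) are the connected
components `P` of `(A_i)_v` (resp. of the edge object `(A_i)_e`), the associated constituent being the
component anabelioid `(𝒢_v)_P`; "`ℋ ×_𝒢 𝒢_i → 𝒢_i` splits over `(𝒢_v)_P`" = "`B_v × P → P` is a
trivial covering", i.e. `B_v × P ≅ ∐ P` over `P`.  A countable collection is an `ℕ`-indexed family.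
(T1) (Galois-countable tempered groups / temperoids) is `SemiGraphs/GaloisCountable.lean` /
`TemperedGroups.lean`; (T3)–(T4) are in `Coverticial.lean`.
-/

namespace Literature.AnabelianGeometry.SemiGraphs

open CategoryTheory CategoryTheory.Limits CategoryTheory.PreGaloisCategory

universe v₁ u₁ u

/-- The *connected components* of an object `X` of a connected anabelioid: its connected subobjects
([SemiAnbd] p. 23 "the set of connected components of the [not necessarily connected!] anabelioid";
[GeoAn] Def. 1.1.8). [cite: MochizukiSemiAnbd2006, Def. 2.2(i) p.23] -/
def π₀Obj {C : Type u₁} [Category.{v₁} C] (X : C) : Type (max u₁ v₁) :=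
  {P : Subobject X // IsConnected (P : C)}

/-- `X` *splits over* `P` (the covering `X × P → P` is trivial): `X × P` is, over `P`, a finite
coproduct of copies of `P` ([IUTchI] Rmk 2.5.3 (i) (T2) "splits over the constituent anabelioid";
[SemiAnbd] Def. 2.3 (iii) "splits"). [cite: Mochizuki2012, IUTchI Rem. 2.5.3(i)(T2) p.52] -/
def SplitsOver {C : Type u₁} [Category.{v₁} C] [HasBinaryProducts C] [HasFiniteCoproducts C]
    (X P : C) : Prop :=
  ∃ (n : ℕ) (e : X ⨯ P ≅ ∐ fun _ : Fin n => P),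
    e.hom ≫ Sigma.desc (fun _ => 𝟙 P) = prod.snd

namespace SemiGraphOfAnabelioids

variable (𝒢 : SemiGraphOfAnabelioids.{v₁, u₁, u})

/-- `𝒢` is *Galois-countable* ([IUTchI] Remark 2.5.3 (i) (T2)): its underlying semi-graph is
countable and there is a countable (here: `ℕ`-indexed) collection of finite étale coverings
`𝒢_i → 𝒢` (objects `A i` of `B(𝒢)`, HONEST coverings: non-initial over every constituent — without
this clause the empty covering makes the condition vacuous, G1 finding L3t7-F1 (L3-t7); print's
"finite étale coverings" intends the same) such that every finite étale covering `ℋ → 𝒢` (object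
`B`) becomes split over every constituent anabelioid of some `𝒢_i` after base change: for every
component `P` of `(A i)_v` and `Q` of `(A i)_e`, `B_v` splits over `P` and `B_e` over `Q`.
[cite: Mochizuki2012, IUTchI Rem. 2.5.3(i)(T2) p.52] -/
@[mk_iff] structure IsGaloisCountable : Prop where
  /-- the underlying semi-graph is countable -/
  isCountable : 𝒢.graph.IsCountable
  /-- a countable cofinal family of finite étale coverings, each non-initial over every constituent -/
  exists_cofinal : ∃ A : ℕ → 𝒢.BObj,
    (∀ (i : ℕ) (v : 𝒢.graph.Vertex), IsInitial ((A i).S v) → False) ∧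
    (∀ (i : ℕ) (e : 𝒢.graph.Edge), IsInitial ((A i).T e) → False) ∧
    ∀ B : 𝒢.BObj, ∃ i : ℕ,
      (∀ (v : 𝒢.graph.Vertex) (P : π₀Obj ((A i).S v)), SplitsOver (B.S v) (P.1 : 𝒢.V v)) ∧
        ∀ (e : 𝒢.graph.Edge) (Q : π₀Obj ((A i).T e)), SplitsOver (B.T e) (Q.1 : 𝒢.E e)

end SemiGraphOfAnabelioids

end Literature.AnabelianGeometry.SemiGraphs
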